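import Mathlib
import HarnessLib
import Literature.Analysis.FluidPDE.ParasiticSlabFlow

/-!
# Crux `PoloidalWindowRigidity` (K2, stmt-NavierStokesRegularity-19708, route `PoloidalWindowDoor`) — negative side:
# the CELLULAR poloidal Type-I profile (kinematics)

Negative-side support (refuter seat ns-regularity-refuter1, cell ns-regularity-ideate; D-0081 §C). This file builds the
witness used in `…Negative.NonflatStubFalseWithoutMild` to show that the registered residue stub `stub_nonflatLiouville`
of K2 is FALSE once the Oseen-mild identity (M) is deleted: the separated cellular profile

  `v(t, x) = (−t)^{-1/2} V(x)`,  `V(x) = (cos x₂ cos x₀, cos x₂ cos x₁, sin x₂ (sin x₀ + sin x₁))`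

(`cellProfile`, `cellField`; indices `0,1,2` as in Lean). `V` is the instance `A = cos x₂`, `P = sin x₀ + sin x₁` of
the kinematic family `V = (A(x₂) ∂₀P, A(x₂) ∂₁P, B(x₂) P)` with `ΔₕP = −P`, `B′ = A` (here `B = sin x₂`): for every
member `div V = A ΔₕP + B′P = 0`, `curl V = ((B + A′)∂₁P, −(B + A′)∂₀P, 0)` is horizontal (poloidal along `e₂`), and
`curl V · ∇V₂ = (B + A′)B (∂₁P ∂₀P − ∂₀P ∂₁P) = 0` (the frozen constraint: `V₂` is a first integral of the vortex
lines). Kernel-checked here for the instance: the derivative `DV` as an explicit continuous linear map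
(`hasFDerivAt_cellField`), `curl V = (2 sin x₂ cos x₁, −2 sin x₂ cos x₀, 0)` (`curl_cellField`), `‖V‖ ≤ 4`, and for the
profile: (R) the Type-I rate with constant `4`, (C) continuity on the open backward slab, (D) divergence-free slices,
(P) poloidality along `e₂`, (F) the frozen constraint.

WHAT THIS IS NOT: not a claim about Navier–Stokes regularity — explicit vector calculus for a kinematic witness.
-/

noncomputable section

-- the summit and its single sub-problem share the name (CONVENTIONS §1), as in every Theorems file
set_option linter.dupNamespace false

namespace Summit.NavierStokesRegularity.NavierStokesRegularity.Theorems.PoloidalWindowRigidity.Negative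

open MeasureTheory Set Function Filter Topology Metric
open scoped RealInnerProductSpace InnerProductSpace ENNReal NNReal
open Literature.Analysis Literature.Analysis.FluidPDE

local notation "E3" => EuclideanSpace ℝ (Fin 3)
local notation "π" i => (EuclideanSpace.proj (𝕜 := ℝ) (i : Fin 3) : EuclideanSpace ℝ (Fin 3) →L[ℝ] ℝ)
local notation "𝐞" i => (EuclideanSpace.single (i : Fin 3) (1 : ℝ) : EuclideanSpace ℝ (Fin 3))

/-! ## The cellular field -/

/-- The cellular poloidal field `V(x) = (cos x₂ cos x₀, cos x₂ cos x₁, sin x₂ (sin x₀ + sin x₁))`. [folklore] -/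
def cellField (x : E3) : E3 :=
  (Real.cos (x 2) * Real.cos (x 0)) • (𝐞 0) + (Real.cos (x 2) * Real.cos (x 1)) • (𝐞 1) +
    (Real.sin (x 2) * (Real.sin (x 0) + Real.sin (x 1))) • (𝐞 2)

/-- The derivative `DV(x)` of the cellular field, as an explicit continuous linear map. [folklore] -/
def cellDeriv (x : E3) : E3 →L[ℝ] E3 :=
  (Real.cos (x 2) • (-(Real.sin (x 0)) • (π 0)) + Real.cos (x 0) • (-(Real.sin (x 2)) • (π 2))).smulRight (𝐞 0) +
  (Real.cos (x 2) • (-(Real.sin (x 1)) • (π 1)) + Real.cos (x 1) • (-(Real.sin (x 2)) • (π 2))).smulRight (𝐞 1) +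
  (Real.sin (x 2) • (Real.cos (x 0) • (π 0) + Real.cos (x 1) • (π 1)) +
      (Real.sin (x 0) + Real.sin (x 1)) • (Real.cos (x 2) • (π 2))).smulRight (𝐞 2)

/-- `V` is differentiable with derivative `cellDeriv`. [folklore] -/
theorem hasFDerivAt_cellField (x : E3) : HasFDerivAt cellField (cellDeriv x) x := by
  have h0 : HasFDerivAt (fun y : E3 => y 0) (π 0) x := (π 0).hasFDerivAt
  have h1 : HasFDerivAt (fun y : E3 => y 1) (π 1) x := (π 1).hasFDerivAt
  have h2 : HasFDerivAt (fun y : E3 => y 2) (π 2) x := (π 2).hasFDerivAt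
  have hc0 := (Real.hasDerivAt_cos (x 0)).comp_hasFDerivAt x h0
  have hc1 := (Real.hasDerivAt_cos (x 1)).comp_hasFDerivAt x h1
  have hc2 := (Real.hasDerivAt_cos (x 2)).comp_hasFDerivAt x h2
  have hs0 := (Real.hasDerivAt_sin (x 0)).comp_hasFDerivAt x h0
  have hs1 := (Real.hasDerivAt_sin (x 1)).comp_hasFDerivAt x h1
  have hs2 := (Real.hasDerivAt_sin (x 2)).comp_hasFDerivAt x h2
  have H := (((hc2.mul hc0).smul_const (𝐞 0)).add ((hc2.mul hc1).smul_const (𝐞 1))).add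
    ((hs2.mul (hs0.add hs1)).smul_const (𝐞 2))
  exact H

/-- `DV = cellDeriv`. [folklore] -/
theorem fderiv_cellField (x : E3) : fderiv ℝ cellField x = cellDeriv x :=
  (hasFDerivAt_cellField x).fderiv

/-- `V` is continuous. [folklore] -/
theorem continuous_cellField : Continuous cellField := by
  have hd : Differentiable ℝ cellField := fun x => (hasFDerivAt_cellField x).differentiableAt
  exact hd.continuous

/-- `DV(x) w` in coordinates. [folklore] -/
theorem cellDeriv_apply (x w : E3) : cellDeriv x w =
    (Real.cos (x 2) * (-(Real.sin (x 0)) * w 0) + Real.cos (x 0) * (-(Real.sin (x 2)) * w 2)) • (𝐞 0) +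
    (Real.cos (x 2) * (-(Real.sin (x 1)) * w 1) + Real.cos (x 1) * (-(Real.sin (x 2)) * w 2)) • (𝐞 1) +
    (Real.sin (x 2) * (Real.cos (x 0) * w 0 + Real.cos (x 1) * w 1) +
      (Real.sin (x 0) + Real.sin (x 1)) * (Real.cos (x 2) * w 2)) • (𝐞 2) := by
  rfl

/-- The components of `V(x)`. [folklore] -/
theorem cellField_apply_zero (x : E3) : cellField x 0 = Real.cos (x 2) * Real.cos (x 0) := by
  simp [cellField]

/-- The second component of `V(x)`. [folklore] -/
theorem cellField_apply_one (x : E3) : cellField x 1 = Real.cos (x 2) * Real.cos (x 1) := by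
  simp [cellField]

/-- The third component of `V(x)`. [folklore] -/
theorem cellField_apply_two (x : E3) : cellField x 2 = Real.sin (x 2) * (Real.sin (x 0) + Real.sin (x 1)) := by
  simp [cellField]

/-- The components of `DV(x) w`. [folklore] -/
theorem cellDeriv_apply_zero (x w : E3) : cellDeriv x w 0 =
    Real.cos (x 2) * (-(Real.sin (x 0)) * w 0) + Real.cos (x 0) * (-(Real.sin (x 2)) * w 2) := by
  rw [cellDeriv_apply]; simp

/-- The second component of `DV(x) w`. [folklore] -/
theorem cellDeriv_apply_one (x w : E3) : cellDeriv x w 1 =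
    Real.cos (x 2) * (-(Real.sin (x 1)) * w 1) + Real.cos (x 1) * (-(Real.sin (x 2)) * w 2) := by
  rw [cellDeriv_apply]; simp

/-- The third component of `DV(x) w`. [folklore] -/
theorem cellDeriv_apply_two (x w : E3) : cellDeriv x w 2 =
    Real.sin (x 2) * (Real.cos (x 0) * w 0 + Real.cos (x 1) * w 1) +
      (Real.sin (x 0) + Real.sin (x 1)) * (Real.cos (x 2) * w 2) := by
  rw [cellDeriv_apply]; simp

/-- **The vorticity of the cellular field**: `curl V = (2 sin x₂ cos x₁, −2 sin x₂ cos x₀, 0)` — horizontal, i.e. `V`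
is poloidal along `e₂`. [folklore] -/
theorem curl_cellField (x : E3) : curl cellField x =
    (2 * Real.sin (x 2) * Real.cos (x 1)) • (𝐞 0) + (-(2 * Real.sin (x 2) * Real.cos (x 0))) • (𝐞 1) := by
  ext i
  fin_cases i <;>
    simp [curl, fderiv_cellField, cellDeriv_apply_zero, cellDeriv_apply_one, cellDeriv_apply_two] <;> ring

/-- `‖V(x)‖ ≤ 4`. [folklore] -/
theorem norm_cellField_le (x : E3) : ‖cellField x‖ ≤ 4 := by
  have hc0 := Real.abs_cos_le_one (x 0)
  have hc1 := Real.abs_cos_le_one (x 1)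
  have hc2 := Real.abs_cos_le_one (x 2)
  have hs0 := Real.abs_sin_le_one (x 0)
  have hs1 := Real.abs_sin_le_one (x 1)
  have hs2 := Real.abs_sin_le_one (x 2)
  have e0 : ‖(𝐞 0)‖ = 1 := by simp
  have e1 : ‖(𝐞 1)‖ = 1 := by simp
  have e2 : ‖(𝐞 2)‖ = 1 := by simp
  unfold cellField
  refine (norm_add_le _ _).trans ?_
  refine (add_le_add (norm_add_le _ _) le_rfl).trans ?_
  rw [norm_smul, norm_smul, norm_smul, e0, e1, e2, mul_one, mul_one, mul_one, Real.norm_eq_abs,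
    Real.norm_eq_abs, Real.norm_eq_abs, abs_mul, abs_mul, abs_mul]
  have h1 : |Real.cos (x 2)| * |Real.cos (x 0)| ≤ 1 := by
    nlinarith [abs_nonneg (Real.cos (x 2)), abs_nonneg (Real.cos (x 0))]
  have h2 : |Real.cos (x 2)| * |Real.cos (x 1)| ≤ 1 := by
    nlinarith [abs_nonneg (Real.cos (x 2)), abs_nonneg (Real.cos (x 1))]
  have h3 : |Real.sin (x 2)| * |Real.sin (x 0) + Real.sin (x 1)| ≤ 2 := by
    have := abs_add_le (Real.sin (x 0)) (Real.sin (x 1))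
    nlinarith [abs_nonneg (Real.sin (x 2)), abs_nonneg (Real.sin (x 0) + Real.sin (x 1))]
  linarith

/-! ## The cellular Type-I profile `v(t, x) = (−t)^{-1/2} V(x)` -/

/-- The Type-I amplitude `(−t)^{-1/2}`. [folklore] -/
def cellAmp (t : ℝ) : ℝ := (Real.sqrt (-t))⁻¹

/-- The cellular profile `v(t, x) = (−t)^{-1/2} V(x)`. [folklore] -/
def cellProfile (t : ℝ) (x : E3) : E3 := cellAmp t • cellField x

/-- `(−t)^{-1/2} ≥ 0` (junk value `0` for `t ≥ 0`). [folklore] -/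
theorem cellAmp_nonneg (t : ℝ) : 0 ≤ cellAmp t := inv_nonneg.2 (Real.sqrt_nonneg _)

/-- `(−t)^{-1/2} > 0` for `t < 0`. [folklore] -/
theorem cellAmp_pos {t : ℝ} (ht : t < 0) : 0 < cellAmp t :=
  inv_pos.2 (Real.sqrt_pos.2 (by linarith))

/-- `Dv(t) = (−t)^{-1/2} DV`. [folklore] -/
theorem fderiv_cellProfile (t : ℝ) (x : E3) : fderiv ℝ (cellProfile t) x = cellAmp t • cellDeriv x :=
  ((hasFDerivAt_cellField x).const_smul (cellAmp t)).fderiv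

/-- `Dv(t)(x) w` in coordinates: `(−t)^{-1/2} (DV(x) w)ᵢ`. [folklore] -/
theorem fderiv_cellProfile_apply (t : ℝ) (x w : E3) (i : Fin 3) :
    fderiv ℝ (cellProfile t) x w i = cellAmp t * cellDeriv x w i := by
  rw [fderiv_cellProfile]; rfl

/-- `curl v(t) = (−t)^{-1/2} curl V`, in coordinates. [folklore] -/
theorem curl_cellProfile (t : ℝ) (x : E3) : curl (cellProfile t) x =
    (cellAmp t * (2 * Real.sin (x 2) * Real.cos (x 1))) • (𝐞 0) +
      (-(cellAmp t * (2 * Real.sin (x 2) * Real.cos (x 0)))) • (𝐞 1) := by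
  ext i
  fin_cases i <;>
    simp [curl, fderiv_cellProfile, cellDeriv_apply_zero, cellDeriv_apply_one, cellDeriv_apply_two] <;> ring

/-- The components of `curl v(t)(x)`. [folklore] -/
theorem curl_cellProfile_apply_zero (t : ℝ) (x : E3) :
    curl (cellProfile t) x 0 = cellAmp t * (2 * Real.sin (x 2) * Real.cos (x 1)) := by
  rw [curl_cellProfile]; simp

/-- The second component of `curl v(t)(x)`. [folklore] -/
theorem curl_cellProfile_apply_one (t : ℝ) (x : E3) :
    curl (cellProfile t) x 1 = -(cellAmp t * (2 * Real.sin (x 2) * Real.cos (x 0))) := by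
  rw [curl_cellProfile]; simp

/-- The third component of `curl v(t)(x)` vanishes (poloidal along `e₂`). [folklore] -/
theorem curl_cellProfile_apply_two (t : ℝ) (x : E3) : curl (cellProfile t) x 2 = 0 := by
  rw [curl_cellProfile]; simp

/-- (R) the Type-I time rate with constant `4`. [folklore] -/
theorem hasTypeITimeDecay_cellProfile : HasTypeITimeDecay 4 cellProfile := by
  intro t ht x
  show ‖cellAmp t • cellField x‖ ≤ 4 / Real.sqrt (-t)
  rw [norm_smul, Real.norm_of_nonneg (cellAmp_nonneg t), cellAmp, div_eq_inv_mul]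
  exact mul_le_mul_of_nonneg_left (norm_cellField_le x) (inv_nonneg.2 (Real.sqrt_nonneg _))

/-- (C) continuity on the open backward slab. [folklore] -/
theorem continuousOn_cellProfile : ContinuousOn (Function.uncurry cellProfile) (Set.Iio (0 : ℝ) ×ˢ Set.univ) := by
  have hamp : ContinuousOn (fun z : ℝ × E3 => cellAmp z.1) (Set.Iio (0 : ℝ) ×ˢ Set.univ) := by
    refine ContinuousOn.inv₀ ?_ fun z hz => (Real.sqrt_pos.2 (neg_pos.2 (show z.1 < 0 from hz.1))).ne'
    exact ((Real.continuous_sqrt.comp continuous_neg).comp continuous_fst).continuousOn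
  exact hamp.smul (continuous_cellField.comp continuous_snd).continuousOn

/-- (D) divergence-free slices: `div V = −cos x₂ sin x₀ − cos x₂ sin x₁ + cos x₂ (sin x₀ + sin x₁) = 0`. [folklore] -/
theorem isDivFree_cellProfile (t : ℝ) : VectorCalculus.IsDivFree (cellProfile t) := by
  intro y
  rw [divergence_eq_sum_inner_fderiv (EuclideanSpace.basisFun (Fin 3) ℝ), Fin.sum_univ_three]
  simp only [EuclideanSpace.basisFun_apply, EuclideanSpace.inner_single_left, map_one, one_mul,
    fderiv_cellProfile_apply,
    cellDeriv_apply_zero, cellDeriv_apply_one, cellDeriv_apply_two, PiLp.single_apply]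
  simp
  ring

/-- (P) poloidal along `e₂` everywhere on every slice. [folklore] -/
theorem poloidal_cellProfile (s : ℝ) (y : E3) : ⟪curl (cellProfile s) y, (𝐞 2)⟫_ℝ = 0 := by
  rw [EuclideanSpace.inner_single_right, curl_cellProfile_apply_two]
  simp

/-- (F) the frozen constraint `⟪Dv(s)(y) curl v(s)(y), e₂⟫ = 0` (`v·e₂` is a first integral of the vortex lines).
[folklore] -/
theorem frozen_cellProfile (s : ℝ) (y : E3) : ⟪fderiv ℝ (cellProfile s) y (curl (cellProfile s) y), (𝐞 2)⟫_ℝ = 0 := by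
  rw [EuclideanSpace.inner_single_right, fderiv_cellProfile_apply, cellDeriv_apply_two, curl_cellProfile_apply_zero,
    curl_cellProfile_apply_one, curl_cellProfile_apply_two, RCLike.conj_to_real]
  ring

end Summit.NavierStokesRegularity.NavierStokesRegularity.Theorems.PoloidalWindowRigidity.Negative

end
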